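import Literature.AlgebraicGeometry.GroupSchemes.ConstantSubgroupOfSections
import Literature.AlgebraicGeometry.GroupSchemes.EtaleOfTrivialUnitComponent
import HarnessLib

/-!
# A finite étale group scheme over an algebraically closed field is the CONSTANT group scheme on its sections
# ([Tate1997FiniteFlatGroupSchemes] (3.7): étale ⇔ constant after separable closure; [StacksProject] Tag 00U3)

Topic `Literature/AlgebraicGeometry/GroupSchemes`; namespace `Literature.AlgebraicGeometry.GroupSchemes.EtaleGroupSchemeConstant`.  PROOF FILE
(theorems only: no definition, no instance, no notation, no named fact, no `sorry`) over ★ `GroupSchemes/ConstantGroupScheme` (p844983),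
★ `GroupSchemes/ConstantSubgroupOfSections` (p844998) and ★ `GroupSchemes/EtaleOfTrivialUnitComponent` (B-p17: `|G(k)| = dim_k Γ(G)`).
Cell `hodgecm-mathlib` (D-0151), FLOOR 0, P6 «MOD programme», DICT organ **(o-c3i)** dealt by F0P6c-plan (g0) (2026-09-01T14:32:14Z):
«a FINITE ÉTALE group scheme over an algebraically closed field is constant on its sections» — consumers: the DICT étale branch (`quot x̄ H`
for `H` étale through ★ `AbelianSchemeConstSubgroupQuotient`, which wants a finite subgroup OF SECTIONS), p10's (o-c3h), HEART (c3b).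
`--supports stmt-HodgeConjecture-24832`; count-neutral: HC_CM is proved only modulo the printed citations until rung 0 closes.

THE STATEMENT.  `k` algebraically closed, `G` a group object of `Over (Spec k)` with `G → Spec k` finite and étale.  Then the embedding
★ `emb G ⊤ : Spec (k^{G(k)}) → G` of the constant scheme on ALL sections (`G(k) = (𝟙_ ⟶ G)`, finite) is an ISOMORPHISM (`isIso_emb_top`);
with the group-object structure of ★ `exists_grpObj_isMonHom_emb` it is an isomorphism of group objects restricting to `s` on the
tautological section at `s` (`exists_grpObj_iso_constOver`); hence morphisms out of `G` are determined by their values on `k`-points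
(`hom_ext_of_sections`), and `|G(k)| = dim_k Γ(G, 𝒪)` (★ `natCard_hom_eq_finrank_of_etale`).
PROOF: over a field two sections with the same reduction coincide (`Spec κ(k) → Spec k` is an isomorphism), so ★
`surjective_sectionsRingHom` (Chinese remainder) makes `Γ(G, 𝒪) → k^{G(k)}` surjective; both sides have `k`-dimension `|G(k)|`
(★ B-p17), so it is bijective (Mathlib `LinearMap.injective_iff_surjective_of_finrank_eq_finrank`) and `emb = Spec (≅) ≫ isoSpec⁻¹`
is an isomorphism.

## References
* [Tate1997FiniteFlatGroupSchemes] J. Tate, *Finite flat group schemes*, in: Cornell–Silverman–Stevens (eds.), *Modular Forms and Fermat's Last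
  Theorem* (Springer 1997), (3.7) (p. 137: a finite étale group scheme becomes constant over the separable closure).
* [StacksProject] The Stacks Project, Tag 00U3 (étale algebras over a separably closed field split).
-/

noncomputable section

set_option backward.isDefEq.respectTransparency false

universe u

open CategoryTheory CategoryTheory.Limits AlgebraicGeometry MonoidalCategory CartesianMonoidalCategory TensorProduct
open scoped MonObj

namespace Literature.AlgebraicGeometry.GroupSchemes.EtaleGroupSchemeConstant

open ConstantGroupScheme ConstantSubgroupOfSections IsLocalRing

variable {k : Type u} [Field k] (G : Over (Spec (.of k))) [GrpObj G]

omit [GrpObj G] in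
/-- Over a FIELD two sections with the same reduction `Spec κ(k) → G` are equal (`residue k : k → κ(k)` is bijective, so `Spec κ(k) → Spec k`
is an isomorphism). [cite: Tate1997FiniteFlatGroupSchemes, (3.7)] -/
theorem eq_of_specMap_residue_comp_eq (s t : 𝟙_ (Over (Spec (.of k))) ⟶ G)
    (h : Spec.map (CommRingCat.ofHom (residue k)) ≫ (s.left : Spec (.of k) ⟶ G.left) =
      Spec.map (CommRingCat.ofHom (residue k)) ≫ (t.left : Spec (.of k) ⟶ G.left)) : s = t := by
  have hbij : Function.Bijective (residue k) := ⟨(residue k).injective, residue_surjective⟩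
  let e : CommRingCat.of k ≅ CommRingCat.of (ResidueField k) := (RingEquiv.ofBijective _ hbij).toCommRingCatIso
  haveI : IsIso (Spec.map (CommRingCat.ofHom (residue k))) := by
    change IsIso (Spec.map e.hom)
    infer_instance
  exact Over.OverMorphism.ext ((cancel_epi (Spec.map (CommRingCat.ofHom (residue k)))).mp h)

/-- The sections `G(k) = (𝟙_ ⟶ G)` of a finite étale group scheme over `k = k̄` form a finite set (`|G(k)| = dim_k Γ(G, 𝒪) ≠ 0`, ★
`natCard_hom_eq_finrank_of_etale`). [cite: StacksProject, Tag 00U3] [cite: Tate1997FiniteFlatGroupSchemes, (3.7)] -/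
theorem finite_hom [IsAlgClosed k] [IsFinite G.hom] [Etale G.hom] : Finite (𝟙_ (Over (Spec (.of k))) ⟶ G) := by
  haveI : IsAffine G.left := isAffine_of_isAffineHom G.hom
  letI : Algebra k Γ(G.left, ⊤) := (Motives.algebraMapΓ G.hom).hom.toAlgebra
  haveI : Module.Finite k Γ(G.left, ⊤) := UnitComponentClopen.finite_ΓSpecIso_inv_comp_appTop G
  haveI : Nontrivial Γ(G.left, ⊤) := (counit G η[G]).domain_nontrivial
  apply Nat.finite_of_card_ne_zero
  rw [natCard_hom_eq_finrank_of_etale G]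
  exact Module.finrank_pos.ne'

/-- **`Γ(G, 𝒪_G) → k^{G(k)}`, `b ↦ (s♯ b)_s`, is BIJECTIVE** for `G` finite étale over `k = k̄`: surjective by the Chinese remainder theorem (★
`surjective_sectionsRingHom`; distinct sections have distinct reductions over a field) and the two sides have the same `k`-dimension `|G(k)|`.
[cite: StacksProject, Tag 00U3] [cite: Tate1997FiniteFlatGroupSchemes, (3.7)] -/
theorem bijective_sectionsRingHom_top [IsAlgClosed k] [IsFinite G.hom] [Etale G.hom] :
    haveI : IsAffine G.left := isAffine_of_isAffineHom G.hom
    Function.Bijective (sectionsRingHom G (⊤ : Subgroup (𝟙_ (Over (Spec (.of k))) ⟶ G))) := by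
  haveI : IsAffine G.left := isAffine_of_isAffineHom G.hom
  haveI := finite_hom G
  letI alg : Algebra k Γ(G.left, ⊤) := (Motives.algebraMapΓ G.hom).hom.toAlgebra
  haveI : Module.Finite k Γ(G.left, ⊤) := UnitComponentClopen.finite_ΓSpecIso_inv_comp_appTop G
  letI : Fintype ↥(⊤ : Subgroup (𝟙_ (Over (Spec (.of k))) ⟶ G)) := Fintype.ofFinite _
  set C := (⊤ : Subgroup (𝟙_ (Over (Spec (.of k))) ⟶ G)) with hC
  have hsurj : Function.Surjective (sectionsRingHom G C) :=
    surjective_sectionsRingHom G C (Set.toFinite _) fun s t h =>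
      Subtype.ext (eq_of_specMap_residue_comp_eq G s.1 t.1 h)
  -- the `k`-linear structure
  let Φ : Γ(G.left, ⊤) →ₐ[k] (↥C → k) :=
    { sectionsRingHom G C with
      commutes' := fun r => funext fun s => counit_structureMap G s.1 r }
  have hΦ : (Φ : Γ(G.left, ⊤) → (↥C → k)) = sectionsRingHom G C := rfl
  have hdim : Module.finrank k Γ(G.left, ⊤) = Module.finrank k (↥C → k) := by
    rw [Module.finrank_pi, ← Nat.card_eq_fintype_card, ← natCard_hom_eq_finrank_of_etale G]
    exact Nat.card_congr (Equiv.Set.univ _).symm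
  refine ⟨?_, hsurj⟩
  rw [← hΦ]
  change Function.Injective Φ.toLinearMap
  exact (LinearMap.injective_iff_surjective_of_finrank_eq_finrank hdim).mpr hsurj

/-- **The embedding `Spec (k^{G(k)}) → G` of the constant scheme on all sections is an ISOMORPHISM** for `G` finite étale over an
algebraically closed field. [cite: Tate1997FiniteFlatGroupSchemes, (3.7)] [cite: StacksProject, Tag 00U3] -/
theorem isIso_emb_top [IsAlgClosed k] [IsFinite G.hom] [Etale G.hom] :
    haveI : IsAffine G.left := isAffine_of_isAffineHom G.hom
    IsIso (emb G (⊤ : Subgroup (𝟙_ (Over (Spec (.of k))) ⟶ G))) := by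
  haveI : IsAffine G.left := isAffine_of_isAffineHom G.hom
  let e : Γ(G.left, ⊤) ≅ CommRingCat.of (↥(⊤ : Subgroup (𝟙_ (Over (Spec (.of k))) ⟶ G)) → k) :=
    (RingEquiv.ofBijective _ (bijective_sectionsRingHom_top G)).toCommRingCatIso
  haveI : IsIso (emb G (⊤ : Subgroup (𝟙_ (Over (Spec (.of k))) ⟶ G))).left := by
    rw [emb_left]
    change IsIso (Spec.map e.hom ≫ G.left.isoSpec.inv)
    infer_instance
  haveI : IsIso ((Over.forget (Spec (CommRingCat.of k))).map (emb G (⊤ : Subgroup (𝟙_ (Over (Spec (.of k))) ⟶ G)))) :=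
    this
  exact isIso_of_reflects_iso _ (Over.forget _)

/-- **A finite étale group scheme over an algebraically closed field is the constant group scheme on its sections** (organ (o-c3i)):
for `G` a group object of `Over (Spec k)`, `k = k̄`, with `G → Spec k` finite étale, there are a group-object structure on the constant scheme
`Spec (k^{G(k)})` (★ `constOver`; `μ`, `η`, `ι` = ★ `mulLift`, the section at `1`, ★ `invLift`) and an ISOMORPHISM of group objects
`e : Spec (k^{G(k)}) ≅ G` whose restriction to the tautological section at `s ∈ G(k)` is `s`. [cite: Tate1997FiniteFlatGroupSchemes, (3.7)]
[cite: StacksProject, Tag 00U3] -/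
theorem exists_grpObj_iso_constOver [IsAlgClosed k] [IsFinite G.hom] [Etale G.hom] :
    ∃ (GC : GrpObj (constOver k ↥(⊤ : Subgroup (𝟙_ (Over (Spec (.of k))) ⟶ G))))
      (e : constOver k ↥(⊤ : Subgroup (𝟙_ (Over (Spec (.of k))) ⟶ G)) ≅ G),
      (letI := GC; IsMonHom e.hom) ∧ ∀ s : ↥(⊤ : Subgroup (𝟙_ (Over (Spec (.of k))) ⟶ G)), constSection k s ≫ e.hom = s.1 := by
  classical
  haveI : IsAffine G.left := isAffine_of_isAffineHom G.hom
  haveI := finite_hom G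
  letI : Fintype ↥(⊤ : Subgroup (𝟙_ (Over (Spec (.of k))) ⟶ G)) := Fintype.ofFinite _
  haveI := isIso_emb_top G
  obtain ⟨GC, hmon⟩ := exists_grpObj_isMonHom_emb G (⊤ : Subgroup (𝟙_ (Over (Spec (.of k))) ⟶ G))
  exact ⟨GC, asIso (emb G ⊤), hmon, fun s => constSection_comp_emb G ⊤ s⟩

/-- **Morphisms out of a finite étale group scheme over `k = k̄` are determined by their values on `k`-points** (in particular
`Hom(G, G′)` embeds in the maps `G(k) → G′(k)`). [cite: Tate1997FiniteFlatGroupSchemes, (3.7)] -/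
theorem hom_ext_of_sections [IsAlgClosed k] [IsFinite G.hom] [Etale G.hom] {Y : Over (Spec (.of k))} (f g : G ⟶ Y)
    (h : ∀ s : 𝟙_ (Over (Spec (.of k))) ⟶ G, s ≫ f = s ≫ g) : f = g := by
  classical
  haveI : IsAffine G.left := isAffine_of_isAffineHom G.hom
  haveI := finite_hom G
  letI : Fintype ↥(⊤ : Subgroup (𝟙_ (Over (Spec (.of k))) ⟶ G)) := Fintype.ofFinite _
  haveI := isIso_emb_top G
  rw [← cancel_epi (emb G (⊤ : Subgroup (𝟙_ (Over (Spec (.of k))) ⟶ G)))]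
  apply Over.OverMorphism.ext
  refine hom_ext_constOver k _ _ fun s => ?_
  rw [Over.comp_left, Over.comp_left, ← Category.assoc, ← Category.assoc, ← Over.comp_left, constSection_comp_emb,
    ← Over.comp_left, ← Over.comp_left, h s.1]

end Literature.AlgebraicGeometry.GroupSchemes.EtaleGroupSchemeConstant

end
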